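import Literature.NumberTheory.Transcendental.PhilipponCriterionNesterenkoProofs
import Literature.NumberTheory.Transcendental.PhilipponMainCriterionHolds
import HarnessLib

/-!
# Discharges of named facts of `PhilipponCriterionNesterenko.lean`

`Literature/NumberTheory/Transcendental/PhilipponCriterionNesterenkoHolds.lean` — proofs-only
sibling of `PhilipponCriterionNesterenko.lean` (no definitions, no named facts). Each theorem
below closes a named fact `X : Prop` of that file as `X_holds : X` by composing an ACCEPTED
reduction theorem of the tree with the ACCEPTED unconditional `_holds` discharges of all of
its hypotheses; nothing is re-proved and no statement is changed. Recorded by the librarian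
sweep g25 (2026-08-16, pass 5c: facts dischargeable in one line from the tree's own lemmas),
so that the facts census, `#h21_route_deps` and the cone guardrail see these facts as
theorems.

Discharged here:

* `NesterenkoPhilippon2001_ch3_thm_2_1_holds` :=
  `NesterenkoPhilippon2001_ch3_thm_2_1_of_mainCriterion` `Philippon1986_mainCriterion_holds`
  (`PhilipponCriterionNesterenkoProofs.lean`).

## References

* [NesterenkoPhilippon2001] — see `lean/references.bib` and the docstring of the fact in `PhilipponCriterionNesterenko.lean`.
-/

namespace Literature.NumberTheory.Transcendental

/-- **Discharge of the named fact `NesterenkoPhilippon2001_ch3_thm_2_1`**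
(`PhilipponCriterionNesterenko.lean`): Philippon's criterion, Nesterenko's form (LNM 1752, Ch.
3, Theorem 2.1): let `ω ∈ ℂⁿ`, `k ≥ 0` an integer, `γ₂ > γ₁ > 0`, and `τ, λ : ℕ → ℝ`
non-decreasing, tending to `∞`, with `λ(N+1)/λ(N) → 1` and `λ(N)/τ(N)^{k+1} → ∞`. … — obtained
as `NesterenkoPhilippon2001_ch3_thm_2_1_of_mainCriterion` applied to the tree's unconditional
discharge `Philippon1986_mainCriterion_holds` of its hypothesis (reduction in
`PhilipponCriterionNesterenkoProofs.lean`).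
[cite: NesterenkoPhilippon2001, Ch. 3 Theorem 2.1 (p. 31); proof via Ch. 8 §1 Corollary 1.2] -/
theorem NesterenkoPhilippon2001_ch3_thm_2_1_holds :
    NesterenkoPhilippon2001_ch3_thm_2_1 :=
  NesterenkoPhilippon2001_ch3_thm_2_1_of_mainCriterion Philippon1986_mainCriterion_holds

end Literature.NumberTheory.Transcendental
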